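import Summits.QuantumFields.YangMills.Theorems.LuscherReductionTwistedTraceScalingBTTauBudget
import HarnessLib

/-!
# The ABSOLUTE TAIL BUDGET of the dressed (B-T) brick at fixed `β`: `τ ≤ κ₂·btC·λ₀(1,L³β)` from four explicit exponential inequalities
# (route `FlatTubeReduction`, crux K1 `NearFlatRatioLaw` stmt-QuantumFields-24720; seat `ym-line-ftr-p1` g15; rate twin «ratepack-v3 / frozen fibres»; R2b1 RECORD rung — no summit
# statement is proved here)

WHY (NOTES T6d; rate twin of lane A's `…BTTauBudget.btTau_le`).  The tail `τ` of `…DressedFixedBeta.dressed_fixed_beta_estimate`,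
`τ = e^{6B}·[e^{3Bα²}t₀ + 2√t₀√(9C + t₀) + e^{−βm_far}I² + (9C + t₀)e^{−Bα²}]`, `t₀ = e^{−βm_nt + β·step(t,σ)}I²`, `I = ∫Ω dπ`, `C = btC` (core weight), `B = L³β`, enters the
dressed brick `…DressedHTFixedBeta.dressed_hT_fixed_beta` through the hypothesis `τ ≤ κ₂·btC·λ₀(1,B)`.  As in lane A, both `τ` and `btC·K₁(1,1)` carry the factor `I²`: the RELATIVE
floor `hG·I² ≤ btC·e^{M₀}` (`…BTCoreFloor.fpBOKernel_one_one_ge`, `hG = Haar(G_c(ρ))`) and the one-site floor `λ₀(1,B) ≥ e^{6B}ℓ(B)` (`…BTTopValue.levelValue_one_site_zero_ge`,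
`ℓ(B) = e^{−3}B^{−9/2}/2000`) reduce the budget to four exponential inequalities (H1) `e^{M₀}e^{3Bα²}e^{−βm_nt+β·step} ≤ (κ₂/12)·hG·ℓ(B)`, (H1') `e^{M₀}e^{−βm_nt+β·step} ≤ hG·((κ₂/12)ℓ(B))²`
(the cross term is a square root), (H2) `e^{M₀}e^{−βm_far} ≤ (κ₂/12)·hG·ℓ(B)`, (H3) `10e^{−Bα²} ≤ (κ₂/12)ℓ(B)`, plus `(κ₂/12)ℓ(B) ≤ 1`.
* ★★★ `dressedTau_le`.
HONEST FRAMING: bookkeeping for a stub of the CONDITIONAL reduction route R2b1 (rate twin); the schedule making (H1)–(H3) hold eventually is separate; femto rung R2b1 (RECORD label);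
not infinite volume, not a gap, not Clay.  No defs, no named facts, no `sorry`.
-/

set_option autoImplicit false

noncomputable section

open MeasureTheory Filter Topology Real
open scoped BigOperators Matrix Quaternion
open Literature.MathematicalPhysics.QuantumFieldTheory
open Literature.MathematicalPhysics.QuantumLattice

namespace Summit.QuantumFields.YangMills.Theorems.FemtoTransferGap.TwoLattice.ConstTube

open Summit.QuantumFields.YangMills.Theorems.FemtoTransferGap
open Summit.QuantumFields.YangMills.Theorems.FemtoTransferGap.TwoLattice
open Summit.QuantumFields.YangMills.Theorems.FemtoTransferGap.TwoLattice.Avg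
open Summit.QuantumFields.YangMills.Theorems.FemtoTransferGap.TwoLattice.Stiff (LinkSpace)
open Summit.QuantumFields.YangMills.Theorems.FemtoTransferGap.TwoLattice.Cov

variable {L : ℕ} [NeZero L]

/-- `2√(xy) ≤ 7·c·θ` when `0 ≤ x ≤ cθ²`, `0 ≤ y ≤ 10c`, `θ, c ≥ 0` (`2√10 ≤ 7`). [folklore] -/
theorem two_sqrt_mul_sqrt_le {x y c θ : ℝ} (hx0 : 0 ≤ x) (hx : x ≤ c * θ ^ 2) (hy : y ≤ 10 * c) (hc : 0 ≤ c) (hθ : 0 ≤ θ) :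
    2 * Real.sqrt x * Real.sqrt y ≤ 7 * c * θ := by
  have h1 : Real.sqrt x * Real.sqrt y = Real.sqrt (x * y) := (Real.sqrt_mul hx0 y).symm
  have hxy : x * y ≤ (c * θ) ^ 2 * 10 := by
    rcases le_or_gt 0 y with hy0 | hy0
    · calc x * y ≤ c * θ ^ 2 * (10 * c) := mul_le_mul hx hy hy0 (by positivity)
        _ = (c * θ) ^ 2 * 10 := by ring
    · have : x * y ≤ 0 := mul_nonpos_of_nonneg_of_nonpos hx0 hy0.le
      linarith [sq_nonneg (c * θ)]
  have h2 : Real.sqrt (x * y) ≤ c * θ * Real.sqrt 10 := by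
    rw [← Real.sqrt_sq (by positivity : 0 ≤ c * θ), ← Real.sqrt_mul (sq_nonneg _)]
    exact Real.sqrt_le_sqrt hxy
  have h10 : Real.sqrt 10 ≤ 7 / 2 := by
    rw [show (7 / 2 : ℝ) = Real.sqrt ((7 / 2) ^ 2) by rw [Real.sqrt_sq (by norm_num)]]
    exact Real.sqrt_le_sqrt (by norm_num)
  rw [mul_assoc, h1]
  nlinarith [mul_le_mul_of_nonneg_left h10 (by positivity : 0 ≤ c * θ)]

set_option maxHeartbeats 800000 in
/-- ★★★ **`τ ≤ κ₂·btC·λ₀(1,L³β)`** for the tail of `dressed_fixed_beta_estimate`, from (H1), (H1'), (H2), (H3). [cite: Luscher1983, §3] -/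
theorem dressedTau_le {β : ℝ} (hβ : 0 ≤ β) (hB1 : 1 ≤ (L : ℝ) ^ 3 * β) (hB2 : 2 / rStar ^ 3 ≤ (L : ℝ) ^ 3 * β)
    {Ω : LinkSpace L → ℝ} (hΩm : Measurable Ω) (hΩ1 : ∀ x, |Ω x| ≤ 1) (hΩ0 : ∀ x, 0 ≤ Ω x) {δ α t R R₁ ε P₀ ρ κ₂ : ℝ}
    (hΩt : ∀ v : Edge 3 L → Fin 3 → ℝ, Ω (linkEmbed L v) ≠ 0 → (∀ (e : Edge 3 L) (c : Fin 3), |v e c| ≤ t) ∧ ‖linkEmbed L v‖ ≤ R)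
    (ht : t ≤ 1 / 30) (hρ0 : 0 ≤ ρ) (hρR : 2 * ρ < R₁) (hρε : 2 * ρ < ε) (hρ1 : ρ < 1) (hκ₂ : 0 ≤ κ₂)
    (hκℓ : κ₂ / 12 * (Real.exp (-3) * ((L : ℝ) ^ 3 * β) ^ (-(9 : ℝ) / 2) / 2000) ≤ 1)
    (H1 : Real.exp (β * ((Fintype.card (Edge 3 L) : ℝ) * (2 * ρ + 2 * Real.sqrt 2 * R) ^ 2) + β * ((10 * Real.sqrt (Fintype.card (Plaquette 3 L × Fin 3)) * R) ^ 2 +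
        stepActionErr (L := L) t 0)) * (Real.exp (3 * ((L : ℝ) ^ 3 * β) * α ^ 2) *
          Real.exp (-(β * btMnt L δ α R R₁ ε) + β * stepActionErr (L := L) t ((L : ℝ) ^ 3 * (12 * δ ^ 4)))) ≤
        κ₂ / 12 * (gaugeMeasure L).real (gaugeCore L ρ) * (Real.exp (-3) * ((L : ℝ) ^ 3 * β) ^ (-(9 : ℝ) / 2) / 2000))
    (H1' : Real.exp (β * ((Fintype.card (Edge 3 L) : ℝ) * (2 * ρ + 2 * Real.sqrt 2 * R) ^ 2) + β * ((10 * Real.sqrt (Fintype.card (Plaquette 3 L × Fin 3)) * R) ^ 2 +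
        stepActionErr (L := L) t 0)) * Real.exp (-(β * btMnt L δ α R R₁ ε) + β * stepActionErr (L := L) t ((L : ℝ) ^ 3 * (12 * δ ^ 4))) ≤
        (gaugeMeasure L).real (gaugeCore L ρ) * (κ₂ / 12 * (Real.exp (-3) * ((L : ℝ) ^ 3 * β) ^ (-(9 : ℝ) / 2) / 2000)) ^ 2)
    (H2 : Real.exp (β * ((Fintype.card (Edge 3 L) : ℝ) * (2 * ρ + 2 * Real.sqrt 2 * R) ^ 2) + β * ((10 * Real.sqrt (Fintype.card (Plaquette 3 L × Fin 3)) * R) ^ 2 +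
        stepActionErr (L := L) t 0)) * Real.exp (-(β * btMfar L δ α R ε P₀)) ≤
        κ₂ / 12 * (gaugeMeasure L).real (gaugeCore L ρ) * (Real.exp (-3) * ((L : ℝ) ^ 3 * β) ^ (-(9 : ℝ) / 2) / 2000))
    (H3 : 10 * Real.exp (-((L : ℝ) ^ 3 * β * α ^ 2)) ≤ κ₂ / 12 * (Real.exp (-3) * ((L : ℝ) ^ 3 * β) ^ (-(9 : ℝ) / 2) / 2000)) :
    Real.exp (6 * ((L : ℝ) ^ 3 * β)) *
        (Real.exp (3 * ((L : ℝ) ^ 3 * β) * α ^ 2) * (Real.exp (-(β * btMnt L δ α R R₁ ε) + β * stepActionErr (L := L) t ((L : ℝ) ^ 3 * (12 * δ ^ 4))) *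
              (∫ v, Ω (linkEmbed L v) ∂orthoTransverse L) ^ 2) +
          2 * Real.sqrt (Real.exp (-(β * btMnt L δ α R R₁ ε) + β * stepActionErr (L := L) t ((L : ℝ) ^ 3 * (12 * δ ^ 4))) * (∫ v, Ω (linkEmbed L v) ∂orthoTransverse L) ^ 2) *
            Real.sqrt (9 * btC L β Ω ε R₁ + Real.exp (-(β * btMnt L δ α R R₁ ε) + β * stepActionErr (L := L) t ((L : ℝ) ^ 3 * (12 * δ ^ 4))) * (∫ v, Ω (linkEmbed L v) ∂orthoTransverse L) ^ 2) +
          Real.exp (-(β * btMfar L δ α R ε P₀)) * (∫ v, Ω (linkEmbed L v) ∂orthoTransverse L) ^ 2 +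
          (9 * btC L β Ω ε R₁ + Real.exp (-(β * btMnt L δ α R R₁ ε) + β * stepActionErr (L := L) t ((L : ℝ) ^ 3 * (12 * δ ^ 4))) * (∫ v, Ω (linkEmbed L v) ∂orthoTransverse L) ^ 2) *
            Real.exp (-((L : ℝ) ^ 3 * β * α ^ 2))) ≤
      κ₂ * btC L β Ω ε R₁ * levelValue su2Rep 1 ((L : ℝ) ^ 3 * β) 0 := by
  -- opaque names
  obtain ⟨B, hBdef⟩ : ∃ B : ℝ, B = (L : ℝ) ^ 3 * β := ⟨_, rfl⟩
  rw [← hBdef] at hB1 hB2 hκℓ H1 H1' H2 H3 ⊢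
  obtain ⟨ℓ, hℓ⟩ : ∃ ℓ : ℝ, ℓ = Real.exp (-3) * B ^ (-(9 : ℝ) / 2) / 2000 := ⟨_, rfl⟩
  obtain ⟨hG, hhG⟩ : ∃ hG : ℝ, hG = (gaugeMeasure L).real (gaugeCore L ρ) := ⟨_, rfl⟩
  obtain ⟨I, hI⟩ : ∃ I : ℝ, I = ∫ v, Ω (linkEmbed L v) ∂orthoTransverse L := ⟨_, rfl⟩
  obtain ⟨M₀, hM₀⟩ : ∃ M₀ : ℝ, M₀ = β * ((Fintype.card (Edge 3 L) : ℝ) * (2 * ρ + 2 * Real.sqrt 2 * R) ^ 2) + β * ((10 * Real.sqrt (Fintype.card (Plaquette 3 L × Fin 3)) * R) ^ 2 +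
    stepActionErr (L := L) t 0) := ⟨_, rfl⟩
  obtain ⟨C, hC⟩ : ∃ C : ℝ, C = btC L β Ω ε R₁ := ⟨_, rfl⟩
  obtain ⟨E₁, hE₁⟩ : ∃ E₁ : ℝ, E₁ = Real.exp (-(β * btMnt L δ α R R₁ ε) + β * stepActionErr (L := L) t ((L : ℝ) ^ 3 * (12 * δ ^ 4))) := ⟨_, rfl⟩
  obtain ⟨E₃, hE₃⟩ : ∃ E₃ : ℝ, E₃ = Real.exp (3 * B * α ^ 2) := ⟨_, rfl⟩
  obtain ⟨E₂, hE₂⟩ : ∃ E₂ : ℝ, E₂ = Real.exp (-(β * btMfar L δ α R ε P₀)) := ⟨_, rfl⟩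
  obtain ⟨E₄, hE₄⟩ : ∃ E₄ : ℝ, E₄ = Real.exp (-(B * α ^ 2)) := ⟨_, rfl⟩
  rw [← hℓ] at hκℓ H1 H1' H2 H3
  rw [← hhG] at H1 H1' H2
  rw [← hM₀] at H1 H1' H2
  rw [← hI, ← hC, ← hE₁, ← hE₃, ← hE₂, ← hE₄]
  rw [← hE₁, ← hE₃] at H1
  rw [← hE₁] at H1'
  rw [← hE₂] at H2
  rw [← hE₄] at H3
  have hB0 : 0 < B := by linarith
  have hℓ0 : 0 < ℓ := by rw [hℓ]; positivity
  have hθ0 : 0 ≤ κ₂ / 12 * ℓ := by positivity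
  have hE₁0 : 0 < E₁ := by rw [hE₁]; exact Real.exp_pos _
  have hE₃0 : 0 < E₃ := by rw [hE₃]; exact Real.exp_pos _
  have hE₂0 : 0 < E₂ := by rw [hE₂]; exact Real.exp_pos _
  have hE₄0 : 0 < E₄ := by rw [hE₄]; exact Real.exp_pos _
  have hlam : Real.exp (6 * B) * ℓ ≤ levelValue su2Rep 1 B 0 := by rw [hℓ]; exact levelValue_one_site_zero_ge hB1 hB2
  have hK1 : transferKernel su2Rep B (1 : GaugeConfig 3 1 SU2) 1 = Real.exp (β * (2 * (Fintype.card (Edge 3 L) : ℝ))) := by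
    rw [hBdef]; exact transferKernel_one_site_one_one_cube (L := L) β
  have hE6 : Real.exp (β * (2 * (Fintype.card (Edge 3 L) : ℝ))) = Real.exp (6 * B) := by rw [hBdef]; exact exp_two_card_edge (L := L) β
  have hWc := measurable_coreWeight (L := L) ε R₁
  -- the relative floor `hG·I² ≤ C·e^{M₀}` (verbatim from `btTau_le`)
  have hfloor := fpBOKernel_one_one_ge hβ hΩm hΩ1 hΩ0 hWc (abs_coreWeight_le ε R₁) (fun g => (coreWeight_mem_Icc ε R₁ g).1) hρ0 ht
    (fun g hg => coreWeight_ge_one_of_mem_gaugeCore hρR hρε hρ1 hg) hΩt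
  have hCeq : fpBOKernel L β Ω (coreWeight L ε R₁) 1 1 = C * Real.exp (6 * B) := by
    rw [hC, btC, ← hBdef, hK1, hE6, div_mul_cancel₀ _ (Real.exp_pos _).ne']
  have hexp_split : Real.exp (β * (2 * (Fintype.card (Edge 3 L) : ℝ)) - β * ((Fintype.card (Edge 3 L) : ℝ) * (2 * ρ + 2 * Real.sqrt 2 * R) ^ 2) -
      β * ((10 * Real.sqrt (Fintype.card (Plaquette 3 L × Fin 3)) * R) ^ 2 + stepActionErr (L := L) t 0)) = Real.exp (6 * B) * Real.exp (-M₀) := by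
    rw [← hE6, ← Real.exp_add]; congr 1; rw [hM₀]; ring
  rw [hexp_split, hCeq, ← hhG, ← hI] at hfloor
  have hC0 : 0 ≤ C := by
    rw [hC]; unfold btC
    exact div_nonneg (fpBOKernel_nonneg β hΩm hΩ1 hΩ0 hWc (abs_coreWeight_le ε R₁) (fun g => (coreWeight_mem_Icc ε R₁ g).1) 1 1) (transferKernel_pos _ _ _ _).le
  have hG0 : 0 ≤ hG := by rw [hhG]; exact measureReal_nonneg
  have hGI : hG * I ^ 2 ≤ C * Real.exp M₀ := by
    have h6 : 0 < Real.exp (6 * B) := Real.exp_pos _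
    have h1 : Real.exp (-M₀) * (hG * I ^ 2) ≤ C := by
      refine le_of_mul_le_mul_left (?_ : Real.exp (6 * B) * (Real.exp (-M₀) * (hG * I ^ 2)) ≤ Real.exp (6 * B) * C) h6
      linarith [hfloor]
    calc hG * I ^ 2 = Real.exp M₀ * (Real.exp (-M₀) * (hG * I ^ 2)) := by rw [← mul_assoc, ← Real.exp_add, add_neg_cancel, Real.exp_zero, one_mul]
      _ ≤ Real.exp M₀ * C := mul_le_mul_of_nonneg_left h1 (Real.exp_pos _).le
      _ = C * Real.exp M₀ := mul_comm _ _
  -- `hG > 0` (else (H3)… no: else (H1) forces `e^{M₀}E₃E₁ ≤ 0`, impossible)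
  have hGpos : 0 < hG := by
    rcases hG0.eq_or_lt with h | h
    · exfalso
      have : Real.exp M₀ * (E₃ * E₁) ≤ 0 := by rw [← h] at H1; simpa using H1
      exact absurd this (not_le.mpr (mul_pos (Real.exp_pos _) (mul_pos hE₃0 hE₁0)))
    · exact h
  -- generic piece: `e^{M₀}·X ≤ κ·hG  ⇒  X·I² ≤ κ·C`
  have piece : ∀ X k : ℝ, 0 ≤ X → Real.exp M₀ * X ≤ k * hG → X * I ^ 2 ≤ k * C := by
    intro X k hX hk
    have h2 : hG * (X * I ^ 2) ≤ hG * (k * C) := by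
      calc hG * (X * I ^ 2) = X * (hG * I ^ 2) := by ring
        _ ≤ X * (C * Real.exp M₀) := mul_le_mul_of_nonneg_left hGI hX
        _ = C * (Real.exp M₀ * X) := by ring
        _ ≤ C * (k * hG) := mul_le_mul_of_nonneg_left hk hC0
        _ = hG * (k * C) := by ring
    exact le_of_mul_le_mul_left h2 hGpos
  -- (a) `E₃·t₀ ≤ (κ₂/12)ℓ·C`
  have pa : E₃ * (E₁ * I ^ 2) ≤ κ₂ / 12 * ℓ * C := by
    have h := piece (E₃ * E₁) (κ₂ / 12 * ℓ) (by positivity) (by calc Real.exp M₀ * (E₃ * E₁) ≤ κ₂ / 12 * hG * ℓ := H1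
      _ = κ₂ / 12 * ℓ * hG := by ring)
    calc E₃ * (E₁ * I ^ 2) = E₃ * E₁ * I ^ 2 := by ring
      _ ≤ κ₂ / 12 * ℓ * C := h
  -- (b) `t₀ ≤ C·θ²`, `θ = (κ₂/12)ℓ ≤ 1`; cross term `≤ 7Cθ`
  have pb0 : E₁ * I ^ 2 ≤ C * (κ₂ / 12 * ℓ) ^ 2 := by
    have h := piece E₁ ((κ₂ / 12 * ℓ) ^ 2) hE₁0.le (by calc Real.exp M₀ * E₁ ≤ hG * (κ₂ / 12 * ℓ) ^ 2 := H1'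
      _ = (κ₂ / 12 * ℓ) ^ 2 * hG := by ring)
    linarith [h]
  have ht0C : E₁ * I ^ 2 ≤ C := by
    have : C * (κ₂ / 12 * ℓ) ^ 2 ≤ C * 1 := mul_le_mul_of_nonneg_left (by nlinarith) hC0
    linarith
  have pb : 2 * Real.sqrt (E₁ * I ^ 2) * Real.sqrt (9 * C + E₁ * I ^ 2) ≤ 7 * C * (κ₂ / 12 * ℓ) :=
    two_sqrt_mul_sqrt_le (by positivity) pb0 (by linarith) hC0 hθ0
  -- (c) far pairs
  have pc : E₂ * I ^ 2 ≤ κ₂ / 12 * ℓ * C :=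
    piece E₂ (κ₂ / 12 * ℓ) hE₂0.le (by calc Real.exp M₀ * E₂ ≤ κ₂ / 12 * hG * ℓ := H2
      _ = κ₂ / 12 * ℓ * hG := by ring)
  -- (d) off-diagonal
  have pd : (9 * C + E₁ * I ^ 2) * E₄ ≤ κ₂ / 12 * ℓ * C := by
    have h1 : (9 * C + E₁ * I ^ 2) * E₄ ≤ 10 * C * E₄ := mul_le_mul_of_nonneg_right (by linarith) hE₄0.le
    have h2 : C * (10 * E₄) ≤ C * (κ₂ / 12 * ℓ) := mul_le_mul_of_nonneg_left H3 hC0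
    linarith [h1, h2]
  -- sum: `[…] ≤ (10/12)κ₂ℓC ≤ κ₂ℓC`, then `e^{6B}ℓ ≤ λ₀`
  have hsum : E₃ * (E₁ * I ^ 2) + 2 * Real.sqrt (E₁ * I ^ 2) * Real.sqrt (9 * C + E₁ * I ^ 2) + E₂ * I ^ 2 + (9 * C + E₁ * I ^ 2) * E₄ ≤ κ₂ * ℓ * C := by
    have : 0 ≤ κ₂ * ℓ * C := by positivity
    linarith [pa, pb, pc, pd]
  have h6 : 0 ≤ Real.exp (6 * B) := (Real.exp_pos _).le
  calc Real.exp (6 * B) * (E₃ * (E₁ * I ^ 2) + 2 * Real.sqrt (E₁ * I ^ 2) * Real.sqrt (9 * C + E₁ * I ^ 2) + E₂ * I ^ 2 + (9 * C + E₁ * I ^ 2) * E₄)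
      ≤ Real.exp (6 * B) * (κ₂ * ℓ * C) := mul_le_mul_of_nonneg_left hsum h6
    _ = κ₂ * C * (Real.exp (6 * B) * ℓ) := by ring
    _ ≤ κ₂ * C * levelValue su2Rep 1 B 0 := mul_le_mul_of_nonneg_left hlam (mul_nonneg hκ₂ hC0)

end Summit.QuantumFields.YangMills.Theorems.FemtoTransferGap.TwoLattice.ConstTube

end
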